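import Mathlib.Analysis.Calculus.MeanValue
import Mathlib.Analysis.Calculus.Deriv.MeanValue
import Mathlib.Analysis.Calculus.Deriv.Add
import Mathlib.Analysis.Calculus.Deriv.Shift
import Mathlib.Analysis.Calculus.ContDiff.Deriv
import Mathlib.Analysis.Calculus.ContDiff.Operations
import Mathlib.Topology.Order.IntermediateValue
import Mathlib.Data.Set.Card
import Mathlib.Data.Int.Interval
import HarnessLib

/-!
# Transverse level crossings of a `C¹` function: order and count

Topic `Literature/Analysis/Calculus`, companion of `MonotonePassages.lean`.  Let `h : ℝ → ℝ` be
`C¹`, `[a, b]` a parameter interval and `Λ ⊆ ℝ` a set of LEVELS which `h` crosses only UPWARDS on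
`[a, b]`: `h' x > 0` whenever `x ∈ [a, b]` and `h x ∈ Λ`.  Then the set of level points
`S = {x ∈ [a, b] | h x ∈ Λ}` is completely described by the endpoint values (PROVED here,
elementary real analysis):

* `lt_of_lt_of_level` / `lt_of_level_of_lt` — to the left of a level point `x₀` the function is
  below `h x₀`, to the right above it (a level, once crossed upwards, is never revisited);
* `strictMonoOn_levelSet` — `h` is strictly increasing on `S` (the `m`-th level point from the
  left sits on the `m`-th level above `h a`);
* `image_levelSet` — if `h a, h b ∉ Λ` then `h '' S = Λ ∩ (h a, h b)`; hence
  `ncard_levelSet : S.ncard = (Λ ∩ (h a, h b)).ncard` and `finite_levelSet_iff`;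
* `ncard_multiples_inter_Ioo` — for the lattice `Λ = p ℤ` (`p > 0`) and `β ∉ p ℤ`,
  `(p ℤ ∩ (α, β)).ncard = ⌊β / p⌋ - ⌊α / p⌋`, so that `ncard_levelSet_multiples` counts the
  solutions of `h x ∈ p ℤ` on `[a, b]` as `⌊h b / p⌋ - ⌊h a / p⌋`.

This is the counting form of "a fast monotone phase against a slow target is resonant exactly
once per turn" used for the new crossings of twisted knot diagrams (with
`SmoothTransitionFlatEnds.smoothTransition_fastPhase` supplying the transversality hypothesis).

[folklore]

## References

* W. Rudin, *Principles of Mathematical Analysis*, 3rd ed. (1976), Thm. 4.23 (intermediate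
  values) and Thm. 5.11 (sign of the derivative and monotonicity). [folklore]
-/

noncomputable section

open Set Filter
open scoped Topology

namespace Literature.Analysis.Calculus

variable {h : ℝ → ℝ} {Λ : Set ℝ} {a b : ℝ}

/-! ## Local strict monotonicity at a point of positive derivative -/

/-- A `C¹` function with `h' x > 0` is strictly increasing on a neighbourhood `(x - ε, x + ε)`.
[folklore] -/
theorem exists_strictMonoOn_Ioo_of_deriv_pos (hh : ContDiff ℝ 1 h) {x : ℝ} (hx : 0 < deriv h x) :
    ∃ ε > 0, StrictMonoOn h (Ioo (x - ε) (x + ε)) := by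
  have hcont : Continuous (deriv h) := hh.continuous_deriv le_rfl
  have hopen : IsOpen {y | 0 < deriv h y} := isOpen_lt continuous_const hcont
  obtain ⟨ε, hε, hball⟩ := Metric.isOpen_iff.1 hopen x hx
  refine ⟨ε, hε, strictMonoOn_of_deriv_pos (convex_Ioo _ _) hh.continuous.continuousOn ?_⟩
  intro y hy
  rw [interior_Ioo] at hy
  apply hball
  rw [Metric.mem_ball, Real.dist_eq, abs_lt]
  constructor <;> linarith [hy.1, hy.2]

/-! ## A level crossed upwards is never revisited -/

/-- **Left of a level point the function is lower.**  If every level point of `[a, b]` is an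
upward crossing (`h' > 0` there), `u < x₀` lie in `[a, b]` and `h x₀ ∈ Λ`, then `h u < h x₀`:
otherwise the first point of `[u, x₀]` on the level `h x₀` after a point above it would be
reached from above, against `h' > 0` there. [folklore] -/
theorem lt_of_lt_of_level (hh : ContDiff ℝ 1 h)
    (hreg : ∀ x ∈ Icc a b, h x ∈ Λ → 0 < deriv h x)
    {u x₀ : ℝ} (hu : u ∈ Icc a b) (hx₀ : x₀ ∈ Icc a b) (hux : u < x₀) (hc : h x₀ ∈ Λ) :
    h u < h x₀ := by
  set c := h x₀ with hcdef
  by_contra hle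
  push Not at hle
  -- Step 1: a point `u' ∈ [u, x₀)` strictly above the level
  obtain ⟨u', huu', hu'x, hcu'⟩ : ∃ u', u ≤ u' ∧ u' < x₀ ∧ c < h u' := by
    rcases hle.lt_or_eq with hlt | heq
    · exact ⟨u, le_rfl, hux, hlt⟩
    · -- `h u = c`: `u` is itself a level point, and `h` increases just after it
      have hureg : 0 < deriv h u := hreg u hu (heq ▸ hc)
      obtain ⟨ε, hε, hmono⟩ := exists_strictMonoOn_Ioo_of_deriv_pos hh hureg
      refine ⟨min (u + ε / 2) ((u + x₀) / 2), ?_, ?_, ?_⟩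
      · exact le_min (by linarith) (by linarith)
      · exact min_lt_of_right_lt (by linarith)
      · have h1 : u ∈ Ioo (u - ε) (u + ε) := ⟨by linarith, by linarith⟩
        have h2 : min (u + ε / 2) ((u + x₀) / 2) ∈ Ioo (u - ε) (u + ε) :=
          ⟨lt_min (by linarith) (by linarith), min_lt_of_left_lt (by linarith)⟩
        have h3 : u < min (u + ε / 2) ((u + x₀) / 2) := lt_min (by linarith) (by linarith)
        have := hmono h1 h2 h3
        rwa [← heq] at this
  -- Step 2: the first level-`c` point `x'` of `[u', x₀]`
  set Z : Set ℝ := Icc u' x₀ ∩ h ⁻¹' {c} with hZ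
  have hZclosed : IsClosed Z := isClosed_Icc.inter (isClosed_singleton.preimage hh.continuous)
  have hZne : Z.Nonempty := ⟨x₀, ⟨hu'x.le, le_rfl⟩, by simp [hcdef]⟩
  have hZbdd : BddBelow Z := ⟨u', fun z hz ↦ hz.1.1⟩
  set x' := sInf Z with hx'
  have hx'Z : x' ∈ Z := hZclosed.csInf_mem hZne hZbdd
  have hx'le : ∀ z ∈ Z, x' ≤ z := fun z hz ↦ csInf_le hZbdd hz
  have hx'c : h x' = c := hx'Z.2
  have hu'x' : u' < x' := by
    rcases (hx'Z.1.1 : u' ≤ x').lt_or_eq with hlt | heq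
    · exact hlt
    · exfalso
      rw [← heq] at hx'c
      exact hcu'.ne' hx'c
  -- Step 3: `h > c` on `[u', x')` (else an earlier level point, by the intermediate value theorem)
  have habove : ∀ y ∈ Ico u' x', c < h y := by
    intro y hy
    by_contra hyc
    push Not at hyc
    have hivt : c ∈ Icc (h y) (h u') := ⟨hyc, hcu'.le⟩
    obtain ⟨z, hz, hzc⟩ := intermediate_value_Icc' hy.1 hh.continuous.continuousOn hivt
    have hzZ : z ∈ Z := ⟨⟨hz.1, hz.2.trans (hy.2.le.trans hx'Z.1.2)⟩, hzc⟩
    exact absurd (hx'le z hzZ) (not_le.2 (hz.2.trans_lt hy.2))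
  -- Step 4: but `x'` is a level point of `[a, b]`, so `h` increases strictly through it
  have hx'ab : x' ∈ Icc a b := ⟨hu.1.trans (huu'.trans hu'x'.le), hx'Z.1.2.trans hx₀.2⟩
  have hreg' : 0 < deriv h x' := hreg x' hx'ab (by rw [hx'c]; exact hc)
  obtain ⟨ε, hε, hmono⟩ := exists_strictMonoOn_Ioo_of_deriv_pos hh hreg'
  set y := max u' (x' - ε / 2) with hy
  have hy1 : y < x' := max_lt hu'x' (by linarith)
  have hy2 : u' ≤ y := le_max_left _ _
  have hyI : y ∈ Ioo (x' - ε) (x' + ε) :=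
    ⟨lt_of_lt_of_le (by linarith) (le_max_right _ _), by linarith⟩
  have hx'I : x' ∈ Ioo (x' - ε) (x' + ε) := ⟨by linarith, by linarith⟩
  have hlt := hmono hyI hx'I hy1
  rw [hx'c] at hlt
  linarith [habove y ⟨hy2, hy1⟩]

/-- **Right of a level point the function is higher** (reflect `x ↦ -x` in `lt_of_lt_of_level`).
[folklore] -/
theorem lt_of_level_of_lt (hh : ContDiff ℝ 1 h)
    (hreg : ∀ x ∈ Icc a b, h x ∈ Λ → 0 < deriv h x)
    {x₀ v : ℝ} (hx₀ : x₀ ∈ Icc a b) (hv : v ∈ Icc a b) (hxv : x₀ < v) (hc : h x₀ ∈ Λ) :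
    h x₀ < h v := by
  -- the reflected function `g x = -h (-x)` on `[-b, -a]` with levels `-Λ`
  set g : ℝ → ℝ := fun x ↦ -h (-x) with hg
  have hgd : ContDiff ℝ 1 g := (hh.comp contDiff_neg).neg
  have hderiv : ∀ x, deriv g x = deriv h (-x) := by
    intro x
    have hg' : g = -(fun y ↦ h (-y)) := rfl
    rw [hg', deriv.neg, deriv_comp_neg, neg_neg]
  have hreg' : ∀ x ∈ Icc (-b) (-a), g x ∈ {c | -c ∈ Λ} → 0 < deriv g x := by
    intro x hx hxΛ
    rw [hderiv]
    refine hreg (-x) ⟨by linarith [hx.2], by linarith [hx.1]⟩ ?_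
    simpa [hg] using hxΛ
  have hu : -v ∈ Icc (-b) (-a) := ⟨by linarith [hv.2], by linarith [hv.1]⟩
  have hx : -x₀ ∈ Icc (-b) (-a) := ⟨by linarith [hx₀.2], by linarith [hx₀.1]⟩
  have hgc : g (-x₀) ∈ {c | -c ∈ Λ} := by simpa [hg] using hc
  have := lt_of_lt_of_level hgd hreg' hu hx (by linarith) hgc
  simp only [hg, neg_neg, neg_lt_neg_iff] at this
  exact this

/-! ## The level set: order, image, cardinality -/

/-- **`h` is strictly increasing on its set of level points**: the level points of `[a, b]`, read
from left to right, sit on strictly increasing levels. [folklore] -/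
theorem strictMonoOn_levelSet (hh : ContDiff ℝ 1 h)
    (hreg : ∀ x ∈ Icc a b, h x ∈ Λ → 0 < deriv h x) :
    StrictMonoOn h {x ∈ Icc a b | h x ∈ Λ} :=
  fun _ hx _ hy hxy ↦ lt_of_lt_of_level hh hreg hx.1 hy.1 hxy hy.2

/-- In particular distinct level points sit on distinct levels. [folklore] -/
theorem injOn_levelSet (hh : ContDiff ℝ 1 h)
    (hreg : ∀ x ∈ Icc a b, h x ∈ Λ → 0 < deriv h x) :
    InjOn h {x ∈ Icc a b | h x ∈ Λ} :=
  (strictMonoOn_levelSet hh hreg).injOn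

/-- Level points compare like their levels. [folklore] -/
theorem lt_iff_lt_of_mem_levelSet (hh : ContDiff ℝ 1 h)
    (hreg : ∀ x ∈ Icc a b, h x ∈ Λ → 0 < deriv h x) {x y : ℝ}
    (hx : x ∈ {x ∈ Icc a b | h x ∈ Λ}) (hy : y ∈ {x ∈ Icc a b | h x ∈ Λ}) :
    h x < h y ↔ x < y :=
  (strictMonoOn_levelSet hh hreg).lt_iff_lt hx hy

/-- **The levels met lie strictly between the endpoint values** (when the endpoints are not on a
level). [folklore] -/
theorem level_mem_Ioo (hh : ContDiff ℝ 1 h)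
    (hreg : ∀ x ∈ Icc a b, h x ∈ Λ → 0 < deriv h x) (ha : h a ∉ Λ) (hb : h b ∉ Λ)
    {x : ℝ} (hx : x ∈ Icc a b) (hxΛ : h x ∈ Λ) : h x ∈ Ioo (h a) (h b) := by
  have hxa : a < x := hx.1.lt_of_ne (by rintro rfl; exact ha hxΛ)
  have hxb : x < b := hx.2.lt_of_ne (by rintro h; rw [h] at hxΛ; exact hb hxΛ)
  have hab : a ≤ b := hx.1.trans hx.2
  exact ⟨lt_of_lt_of_level hh hreg (left_mem_Icc.2 hab) hx hxa hxΛ,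
    lt_of_level_of_lt hh hreg hx (right_mem_Icc.2 hab) hxb hxΛ⟩

/-- **The levels met are exactly the levels strictly between the endpoint values.** [folklore] -/
theorem image_levelSet (hh : ContDiff ℝ 1 h)
    (hreg : ∀ x ∈ Icc a b, h x ∈ Λ → 0 < deriv h x) (hab : a ≤ b) (ha : h a ∉ Λ)
    (hb : h b ∉ Λ) : h '' {x ∈ Icc a b | h x ∈ Λ} = Λ ∩ Ioo (h a) (h b) := by
  ext c
  constructor
  · rintro ⟨x, ⟨hx, hxΛ⟩, rfl⟩
    exact ⟨hxΛ, level_mem_Ioo hh hreg ha hb hx hxΛ⟩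
  · rintro ⟨hcΛ, hc⟩
    obtain ⟨x, hx, rfl⟩ := intermediate_value_Ioo hab hh.continuous.continuousOn hc
    exact ⟨x, ⟨Ioo_subset_Icc_self hx, hcΛ⟩, rfl⟩

/-- **Counting level points by counting levels**: the number of solutions of `h x ∈ Λ` on
`[a, b]` is the number of levels strictly between `h a` and `h b` (both sides `Set.ncard`, so
`0 = 0` if infinite). [folklore] -/
theorem ncard_levelSet (hh : ContDiff ℝ 1 h)
    (hreg : ∀ x ∈ Icc a b, h x ∈ Λ → 0 < deriv h x) (hab : a ≤ b) (ha : h a ∉ Λ)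
    (hb : h b ∉ Λ) : {x ∈ Icc a b | h x ∈ Λ}.ncard = (Λ ∩ Ioo (h a) (h b)).ncard := by
  rw [← image_levelSet hh hreg hab ha hb, (injOn_levelSet hh hreg).ncard_image]

/-- The level set is finite iff finitely many levels lie strictly between the endpoint values.
[folklore] -/
theorem finite_levelSet_iff (hh : ContDiff ℝ 1 h)
    (hreg : ∀ x ∈ Icc a b, h x ∈ Λ → 0 < deriv h x) (hab : a ≤ b) (ha : h a ∉ Λ)
    (hb : h b ∉ Λ) : {x ∈ Icc a b | h x ∈ Λ}.Finite ↔ (Λ ∩ Ioo (h a) (h b)).Finite := by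
  rw [← image_levelSet hh hreg hab ha hb, finite_image_iff (injOn_levelSet hh hreg)]

/-- If `h b ≤ h a` there are no level points at all. [folklore] -/
theorem levelSet_eq_empty_of_le (hh : ContDiff ℝ 1 h)
    (hreg : ∀ x ∈ Icc a b, h x ∈ Λ → 0 < deriv h x) (ha : h a ∉ Λ) (hb : h b ∉ Λ)
    (hba : h b ≤ h a) : {x ∈ Icc a b | h x ∈ Λ} = ∅ := by
  ext x
  simp only [mem_setOf_eq, mem_empty_iff_false, iff_false, not_and]
  intro hx hxΛ
  have := level_mem_Ioo hh hreg ha hb hx hxΛ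
  linarith [this.1, this.2]

/-! ## Lattice levels `p ℤ` -/

/-- The multiples of `p > 0` strictly between `α` and `β ∉ p ℤ` are `p n` for
`⌊α / p⌋ < n ≤ ⌊β / p⌋`. [folklore] -/
theorem setOf_multiples_mem_Ioo_eq {p α β : ℝ} (hp : 0 < p) (hβ : ∀ n : ℤ, β ≠ p * n) :
    {n : ℤ | α < p * n ∧ p * n < β} = Ioc ⌊α / p⌋ ⌊β / p⌋ := by
  ext n
  simp only [mem_setOf_eq, mem_Ioc]
  constructor
  · rintro ⟨h1, h2⟩
    refine ⟨Int.floor_lt.2 ?_, Int.le_floor.2 ?_⟩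
    · rw [div_lt_iff₀ hp]; linarith [mul_comm p (n : ℝ)]
    · rw [le_div_iff₀ hp]; linarith [mul_comm p (n : ℝ)]
  · rintro ⟨h1, h2⟩
    have h1' := Int.floor_lt.1 h1
    have h2' := Int.le_floor.1 h2
    rw [div_lt_iff₀ hp] at h1'
    rw [le_div_iff₀ hp] at h2'
    refine ⟨by linarith [mul_comm p (n : ℝ)], ?_⟩
    rcases h2'.lt_or_eq with hlt | heq
    · linarith [mul_comm p (n : ℝ)]
    · exact absurd (by rw [← heq, mul_comm]) (hβ n)

/-- **Lattice points in an open interval**: for `p > 0` and `β ∉ p ℤ` the set `p ℤ ∩ (α, β)` has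
`⌊β / p⌋ - ⌊α / p⌋` elements (truncated at `0`). [folklore] -/
theorem ncard_multiples_inter_Ioo {p α β : ℝ} (hp : 0 < p) (hβ : ∀ n : ℤ, β ≠ p * n) :
    (range (fun n : ℤ ↦ p * n) ∩ Ioo α β).ncard = (⌊β / p⌋ - ⌊α / p⌋).toNat := by
  have hset : range (fun n : ℤ ↦ p * n) ∩ Ioo α β =
      (fun n : ℤ ↦ p * n) '' {n : ℤ | α < p * n ∧ p * n < β} := by
    ext c
    constructor
    · rintro ⟨⟨n, rfl⟩, h1, h2⟩
      exact ⟨n, ⟨h1, h2⟩, rfl⟩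
    · rintro ⟨n, ⟨h1, h2⟩, rfl⟩
      exact ⟨⟨n, rfl⟩, h1, h2⟩
  have hinj : Function.Injective (fun n : ℤ ↦ p * (n : ℝ)) := by
    intro m n hmn
    have : (m : ℝ) = n := mul_left_cancel₀ hp.ne' hmn
    exact_mod_cast this
  rw [hset, ncard_image_of_injective _ hinj, setOf_multiples_mem_Ioo_eq hp hβ, ← Finset.coe_Ioc,
    ncard_coe_finset, Int.card_Ioc]

/-- The multiples of `p > 0` in an open interval form a finite set. [folklore] -/
theorem finite_multiples_inter_Ioo {p : ℝ} (hp : 0 < p) (α β : ℝ) :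
    (range (fun n : ℤ ↦ p * n) ∩ Ioo α β).Finite := by
  have hsub : range (fun n : ℤ ↦ p * n) ∩ Ioo α β ⊆
      (fun n : ℤ ↦ p * n) '' (Icc ⌊α / p⌋ ⌈β / p⌉ : Set ℤ) := by
    rintro c ⟨⟨n, rfl⟩, h1, h2⟩
    refine ⟨n, ⟨?_, ?_⟩, rfl⟩
    · refine Int.floor_le_iff.2 ?_  -- ⌊α/p⌋ ≤ n ↔ α/p < n + 1
      rw [div_lt_iff₀ hp]
      have : α < p * n := h1
      nlinarith
    · refine Int.le_ceil_iff.2 ?_  -- n ≤ ⌈β/p⌉ ↔ (n:ℝ) - 1 < β/p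
      rw [lt_div_iff₀ hp]
      have : p * n < β := h2
      nlinarith
  exact ((Set.finite_Icc _ _).image _).subset hsub

/-- **Counting the solutions of `h x ∈ p ℤ`**: if `h` crosses the lattice `p ℤ` only upwards on
`[a, b]` (`a ≤ b`) and `h a, h b ∉ p ℤ`, the solutions of `h x ∈ p ℤ` in `[a, b]` form a finite
set with `⌊h b / p⌋ - ⌊h a / p⌋` elements, on which `h` is strictly increasing. [folklore] -/
theorem ncard_levelSet_multiples (hh : ContDiff ℝ 1 h) {p : ℝ} (hp : 0 < p) (hab : a ≤ b)
    (hreg : ∀ x ∈ Icc a b, (∃ n : ℤ, h x = p * n) → 0 < deriv h x)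
    (ha : ∀ n : ℤ, h a ≠ p * n) (hb : ∀ n : ℤ, h b ≠ p * n) :
    {x ∈ Icc a b | ∃ n : ℤ, h x = p * n}.Finite ∧
      {x ∈ Icc a b | ∃ n : ℤ, h x = p * n}.ncard = (⌊h b / p⌋ - ⌊h a / p⌋).toNat := by
  set Λ : Set ℝ := range (fun n : ℤ ↦ p * n) with hΛ
  have hmem : ∀ c : ℝ, c ∈ Λ ↔ ∃ n : ℤ, c = p * n := fun c ↦
    ⟨fun ⟨n, hn⟩ ↦ ⟨n, hn.symm⟩, fun ⟨n, hn⟩ ↦ ⟨n, hn.symm⟩⟩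
  have hset : {x ∈ Icc a b | ∃ n : ℤ, h x = p * n} = {x ∈ Icc a b | h x ∈ Λ} := by
    ext x; simp only [mem_setOf_eq, hmem]
  have hreg' : ∀ x ∈ Icc a b, h x ∈ Λ → 0 < deriv h x := fun x hx hxΛ ↦
    hreg x hx ((hmem _).1 hxΛ)
  have ha' : h a ∉ Λ := fun haΛ ↦ by obtain ⟨n, hn⟩ := (hmem _).1 haΛ; exact ha n hn
  have hb' : h b ∉ Λ := fun hbΛ ↦ by obtain ⟨n, hn⟩ := (hmem _).1 hbΛ; exact hb n hn
  rw [hset]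
  refine ⟨(finite_levelSet_iff hh hreg' hab ha' hb').2 (finite_multiples_inter_Ioo hp _ _), ?_⟩
  rw [ncard_levelSet hh hreg' hab ha' hb', ncard_multiples_inter_Ioo hp hb]

end Literature.Analysis.Calculus
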